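import Literature.NumberTheory.EllipticCurves.ModularityVersionApProofs
import Literature.NumberTheory.EllipticCurves.LFunctionCoefficientBound
import Literature.NumberTheory.EllipticCurves.CuspFormLFunctionLevelConductorProofs
import Literature.NumberTheory.EllipticCurves.CuspFormLFunctionNewformFrickeProofs
import Summits.BirchSwinnertonDyer.BirchSwinnertonDyer.Theorems.ManinLocalTwoThreeCurveExclusionFortyFour
import HarnessLib

/-!
# Level 52 (C2, `52 = 4·13`, genus 5), part 1: curve side, coordinate solve, and the FRICKE SIEVE

Cell `bsd-f2-manin`, route `ManinLocalTwoThree`, crux C2 `ManinOddAtFour` (stmt-BirchSwinnertonDyer-22967; `--supports` helper):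
an g51's sketch `Sketch-an-g51-L52.lean` (`11fa2351dc93ab75`, TURNKEY T-an-g51-52) landed verbatim by LEAD p1 g24 (namespace moved
under `…Theorems.ManinLocalTwoThree.LevelFiftyTwo`).
Level 52 is the first `C2` level where the old-form exclusion of the pinning device cannot be done with explicit
lower-level forms: `S₂(Γ₀(26))` (dimension 2, newforms 26a, 26b) contains **no** `η`-quotient and `M₂(Γ₀(26))` no
holomorphic `η`-quotient at all, while the curve-side recursion at level 52 leaves, besides the newform `52a`, the two
"odd parts" `h = f₂₆(τ) − a₂(f₂₆) f₂₆(2τ)` of `26a`, `26b` (normalised Hecke eigenforms of level 52 with integer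
eigenvalues and `a₂ = 0`, but OLD).  The new device that removes them is the **Fricke sieve**:

* `D.f` is a `w_N`-eigenform with eigenvalue `±1` — a THEOREM of the tree (`IsNewform0.frickeInvolution_eq_smul_holds`,
  `IsNewform0.frickeEigenvalue_eq_one_or_eq_neg_one_holds`, Atkin–Lehner via all-`p` multiplicity one; standard axioms);
* `w_N` acts on `η`-quotients of level `N` by the involution `r_δ ↦ r_{N/δ}` of the exponent vector, with the constant
  `−N/√(∏ δ^{r_δ})` at weight 2 (from `η(−1/z) = √(z/i) η(z)` alone — no multiplier system; numerically certified in
  `scripts/l52c.out`, to be typed as one Literature lemma `etaQuotient_slash_frickeGL`);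
* on a `σ`-CLOSED holomorphic `η`-basis `C₁, …, C₁₀` of `M₂(Γ₀(52))` (below) `w₅₂` is therefore a signed scalar
  permutation of the coordinates, and the coordinate vector of `D.f` must be a `±1`-eigenvector of it (§D,
  `fricke_coords`, abstract over any finite family of functions); the odd parts are not (one row suffices:
  `−¼·x₇ = ε·x₈`), `52a` is, with `ε = −1 = −w(52a)`.

The basis (exponents `δ ↦ r_δ` on `δ ∣ 52`; `σ : δ ↦ 52/δ`; `κ = −52/√∏δ^{r_δ}`):
`C₁ = η₁η₄³η₁₃³η₅₂/(η₂²η₂₆²)` (`σ`-fixed, `κ = −1`), `C₂ = η₁³η₄η₁₃η₅₂³/(η₂²η₂₆²)` (`σ`-fixed, `κ = −1`),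
`C₃ = η₄⁴η₅₂⁴/(η₂²η₂₆²) ↔ C₄ = η₁⁴η₁₃⁴/(η₂²η₂₆²)` (`κ₃ = −1/16`, `κ₄ = −16`), `C₅ = η₄⁸/η₂⁴ ↔ C₆ = η₁₃⁸/η₂₆⁴`
(`κ₅ = −13/16`, `κ₆ = −16/13`), `C₇ = η₂η₄²η₂₆⁷/(η₁η₁₃³η₅₂²) ↔ C₈ = η₂⁷η₁₃²η₂₆/(η₁²η₄³η₅₂)` (`κ₇ = −¼`, `κ₈ = −4`),
`C₉ = η₂⁷η₂₆η₅₂²/(η₁³η₄²η₁₃) ↔ C₁₀ = η₁²η₂η₂₆⁷/(η₄η₁₃²η₅₂³)` (`κ₉ = −¼`, `κ₁₀ = −4`); pivots `n = 1,…,8,13,26`;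
`52a = −C₁ − C₂ + C₇ + ¼C₈ − C₉ − ¼C₁₀` (verified against the point counts of `[0,0,0,1,−10]` to `q²⁰⁰`).

Contents: §A Hasse at 3 for `W.LFunction`, hypothesis-free; §B the curve side (integers + Hasse at 3; columns 9,
15, 21, 39); §C the coordinate solve on `C₁..C₁₀` (three solutions); §D the Fricke sieve: the abstract coordinate relation
`fricke_coords` (any level, any finite function family) and the level-52 conclusion `coeffVector_fiftyTwo_of_fricke`.
Everything here is sorry-free over the standard axioms; nothing here proves C2, Manin's conjecture or BSD.  Data:
`HOME/an/g51/scripts/l52data.py|out`, `l52c.py|out` (certificates, identities, numerical check of the `η`-Fricke law),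
`certlin-52-M2.out` (basis-free relations).  [cite: DiamondShurman2005, §5.8, §8.8] [cite: AtkinLehner1970, Thm. 3]
[cite: CremonaAlgorithms1997, Table 3 (N = 52)] [cite: SilvermanAEC2009, Thm. V.1.1]
-/

set_option autoImplicit false
-- lint-debt: the directory name repeats the summit name (sibling precedent `ManinLocalTwoThreeCurveExclusionFortyFour.lean`)
set_option linter.dupNamespace false

open Complex Filter Topology Set Function
open UpperHalfPlane hiding I
open scoped Real Topology MatrixGroups ModularForm
open ModularForm CongruenceSubgroup
open Literature.NumberTheory.EllipticCurves Literature.NumberTheory.EllipticCurves.ModularForms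

namespace Summit.BirchSwinnertonDyer.BirchSwinnertonDyer.Theorems.ManinLocalTwoThree.LevelFiftyTwo

/-! ## §A Hasse at 3 for `W.LFunction`, with NO reduction hypothesis -/

section Hasse

/-- `a₃(W)² ≤ 12` for EVERY elliptic `W/ℚ` — Hasse at 3 with no good-reduction / minimality hypothesis
(tree `WeierstrassCurve.abs_LFunction_prime_pow_le`: `|a_{p^k}| ≤ (k+1)√p^k` at every prime, bad ones included;
this is the form LEAD p1 g24 used in `Theorems/ManinLocalTwoThreeCurveExclusionFortyFour.lean`). [folklore]
[cite: SilvermanAEC2009, Thm. V.1.1] -/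
theorem lFunction_three_sq_le (W : WeierstrassCurve ℚ) [W.IsElliptic] : W.LFunction 3 ^ 2 ≤ 12 := by
  have h := W.abs_LFunction_prime_pow_le Nat.prime_three 1
  rw [pow_one, pow_one] at h
  norm_num at h
  have h2 := mul_le_mul h h (abs_nonneg _) (by positivity)
  rw [abs_mul_abs_self] at h2
  have h12 : (2 * Real.sqrt 3) * (2 * Real.sqrt 3) = 12 := by
    rw [mul_mul_mul_comm, Real.mul_self_sqrt (by norm_num : (0:ℝ) ≤ 3)]; norm_num
  rw [h12] at h2
  have : ((W.LFunction 3 ^ 2 : ℤ) : ℝ) ≤ 12 := by push_cast; rw [sq]; exact h2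
  exact_mod_cast this

end Hasse

/-! ## §B The curve side at level 52 (integers + Hasse at 3; columns 9, 15, 21, 39) -/

section CurveSide

variable (W : WeierstrassCurve ℚ) [W.IsElliptic]

omit [W.IsElliptic] in

omit [W.IsElliptic] in
/-- `a_{mn} = a_m a_n` for coprime `m, n`. [cite: DiamondShurman2005, §8.8 (8.44)] -/
theorem lFunction_mul {m n : ℕ} (h : Nat.Coprime m n) : W.LFunction (m * n) = W.LFunction m * W.LFunction n :=
  W.isMultiplicative_LFunction.map_mul_of_coprime h

/-- `a_{p²} = a_p·a_p − 𝟙_{N_W}(p)·p`. [cite: DiamondShurman2005, §8.8 (8.44)] -/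
theorem lFunction_prime_sq {p : ℕ} (hp : p.Prime) : W.LFunction (p ^ 2) = W.LFunction p * W.LFunction p -
    (if p ∣ W.conductorNorm ℤ then 0 else (p : ℤ)) := by
  have h := W.LFunction_apply_prime_pow_add_two_of_prime hp 0
  simp only [zero_add, pow_one, pow_zero, WeierstrassCurve.LFunction_apply_one, mul_one] at h
  exact h

/-- `a_{p³} = a_p·a_{p²} − 𝟙_{N_W}(p)·p·a_p`. [cite: DiamondShurman2005, §8.8 (8.44)] -/
theorem lFunction_prime_cube {p : ℕ} (hp : p.Prime) : W.LFunction (p ^ 3) = W.LFunction p * W.LFunction (p ^ 2) -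
    (if p ∣ W.conductorNorm ℤ then 0 else (p : ℤ) * W.LFunction p) := by
  have h := W.LFunction_apply_prime_pow_add_two_of_prime hp 1
  simp only [pow_one] at h
  rw [h]; split_ifs <;> ring


/-- `a₈ = a₂ a₄ − 2𝟙 a₂`. [cite: DiamondShurman2005, §8.8 (8.44)] -/
theorem lFunction_eight : W.LFunction 8 = W.LFunction 2 * W.LFunction 4 -
    (if 2 ∣ W.conductorNorm ℤ then 0 else 2 * W.LFunction 2) := by
  have h := lFunction_prime_cube W Nat.prime_two; norm_num at h; rw [h]


omit [W.IsElliptic] in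
/-- `a₆ = a₂a₃`, `a₁₅ = a₃a₅`, `a₂₁ = a₃a₇`, `a₂₆ = a₂a₁₃`, `a₃₉ = a₃a₁₃`. [cite: DiamondShurman2005, §8.8 (8.44)] -/
theorem lFunction_products : W.LFunction 6 = W.LFunction 2 * W.LFunction 3 ∧
    W.LFunction 15 = W.LFunction 3 * W.LFunction 5 ∧ W.LFunction 21 = W.LFunction 3 * W.LFunction 7 ∧
    W.LFunction 26 = W.LFunction 2 * W.LFunction 13 ∧ W.LFunction 39 = W.LFunction 3 * W.LFunction 13 :=
  ⟨lFunction_mul W (show Nat.Coprime 2 3 by norm_num), lFunction_mul W (show Nat.Coprime 3 5 by norm_num),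
    lFunction_mul W (show Nat.Coprime 3 7 by norm_num), lFunction_mul W (show Nat.Coprime 2 13 by norm_num),
    lFunction_mul W (show Nat.Coprime 3 13 by norm_num)⟩

/-- **Curve side at 52.**  With `a₂(W) = 0` (from `a₂(D.f) = 0`, `2² ∣ 52`, tree
`cuspCoeff_eq_zero_of_sq_dvd_of_mem_newSubspace0`), `2 ∣ N_W`, `3 ∤ N_W` (tree `IsNewformOf.dvd_level_iff_dvd_conductorNorm`
at the level 52), Hasse at 3 (hypothesis-free, §A), and the basis-free relations of `M₂(Γ₀(52))` at the columns `9, 15, 21, 39`: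
`a₄ = a₆ = a₈ = a₂₆ = 0` and `(a₃, a₅, a₇, a₁₃) ∈ {(0, 2, −2, −1) = 52a, (1, −3, −1, 1) = odd part of 26a,
(−3, −1, 1, −1) = odd part of 26b}`.  Hasse at 3 is load-bearing: the Eisenstein series `G − 13·G(13τ)`,
`G = η₄⁸/η₂⁴ = Σ_{n odd} σ(n) qⁿ`, solves every other constraint with `(a₃, a₅, a₇, a₁₃) = (4, 6, 8, 1)`.
[cite: DiamondShurman2005, §8.8 (8.44)] [cite: SilvermanAEC2009, Thm. V.1.1] -/
theorem curveSide_fiftyTwo (ha2 : W.LFunction 2 = 0) (h2N : 2 ∣ W.conductorNorm ℤ)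
    (h3N : ¬ 3 ∣ W.conductorNorm ℤ) (h9 : W.LFunction 9 = 1 - W.LFunction 3 + 2 * W.LFunction 7)
    (h15 : W.LFunction 15 = 2 + W.LFunction 5 + 2 * W.LFunction 7)
    (h21 : W.LFunction 21 = 2 + 2 * W.LFunction 3 + W.LFunction 5 + 2 * W.LFunction 7)
    (h39 : W.LFunction 39 = 2 - 2 * W.LFunction 3 + W.LFunction 5 + 4 * W.LFunction 13) :
    W.LFunction 4 = 0 ∧ W.LFunction 6 = 0 ∧ W.LFunction 8 = 0 ∧ W.LFunction 26 = 0 ∧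
      ((W.LFunction 3 = 0 ∧ W.LFunction 5 = 2 ∧ W.LFunction 7 = -2 ∧ W.LFunction 13 = -1) ∨
        (W.LFunction 3 = 1 ∧ W.LFunction 5 = -3 ∧ W.LFunction 7 = -1 ∧ W.LFunction 13 = 1) ∨
        (W.LFunction 3 = -3 ∧ W.LFunction 5 = -1 ∧ W.LFunction 7 = 1 ∧ W.LFunction 13 = -1)) := by
  have hH3 := lFunction_three_sq_le W
  obtain ⟨hm6, hm15, hm21, hm26, hm39⟩ := lFunction_products W
  have hrec9 := LevelFortyFour.lFunction_nine W
  have hrec4 := LevelFortyFour.lFunction_four W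
  have hrec8 := lFunction_eight W
  rw [ha2] at hm6 hrec4 hrec8 hm26
  rw [if_pos h2N, sub_zero, mul_zero] at hrec4
  have ha8 : W.LFunction 8 = 0 := by rw [hrec8, if_pos h2N]; ring
  refine ⟨hrec4, by rw [hm6]; ring, ha8, by rw [hm26]; ring, ?_⟩
  rw [h9, if_neg h3N] at hrec9
  rw [h15] at hm15
  rw [h21] at hm21
  rw [h39] at hm39
  have ht1 : W.LFunction 3 ≤ 3 := by nlinarith
  have ht2 : -3 ≤ W.LFunction 3 := by nlinarith
  clear hH3
  generalize W.LFunction 3 = t at hrec9 hm15 hm21 hm39 ht1 ht2 ⊢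
  generalize W.LFunction 5 = u at hm15 hm21 hm39 ⊢
  generalize W.LFunction 7 = v at hrec9 hm15 hm21 ⊢
  generalize W.LFunction 13 = w at hm39 ⊢
  interval_cases t
  · omega
  · omega
  · omega
  · omega
  · omega
  · omega
  · omega

end CurveSide

/-! ## §C The coordinate solve on the `σ`-closed basis `C₁, …, C₁₀` of `M₂(Γ₀(52))` -/

section Coordinates

variable (W : WeierstrassCurve ℚ) [W.IsElliptic]

/-- **Coordinates at 52.**  If `x₁, …, x₁₀` are the coordinates on `(C₁, …, C₁₀)` of a form with `aₙ = aₙ(W)` at the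
columns `n = 1, …, 8, 13, 26` (pivots) and `9, 15, 21, 39` (relations) — column equations from the certified `q`-table
of `scripts/l52c.out` — and `a₂(W) = 0`, `2 ∣ N_W`, `3 ∤ N_W`, then `x` is the vector of `52a`
`(−1, −1, 0, 0, 0, 0, 1, ¼, −1, −¼)`, of the odd part of `26a` `(9/2, 3/2, −14, 0, 2, 0, −9/2, −¼, 3/2, ¼)` or of the odd
part of `26b` `(½, ½, 0, 0, 0, 0, −½, ¼, ½, −¼)`.
[cite: DiamondShurman2005, §8.8 (8.44)] [cite: CremonaAlgorithms1997, Table 3 (N = 52)] -/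
theorem coeffVector_fiftyTwo (ha2 : W.LFunction 2 = 0) (h2N : 2 ∣ W.conductorNorm ℤ)
    (h3N : ¬ 3 ∣ W.conductorNorm ℤ) (x₁ x₂ x₃ x₄ x₅ x₆ x₇ x₈ x₉ x₁₀ : ℂ)
    (k1 : -4 * x₄ + x₅ + 2 * x₈ - 2 * x₁₀ = (W.LFunction 1 : ℂ))
    (k2 : x₁ + 4 * x₄ + x₇ - 2 * x₈ - 2 * x₁₀ = (W.LFunction 2 : ℂ))
    (k3 : -x₁ + 4 * x₅ + x₇ - 4 * x₈ + 4 * x₁₀ = (W.LFunction 3 : ℂ))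
    (k4 : x₁ + 4 * x₄ + x₇ + 2 * x₈ + 2 * x₁₀ = (W.LFunction 4 : ℂ))
    (k5 : -2 * x₁ + x₂ - 8 * x₄ + 6 * x₅ + 2 * x₇ + x₉ = (W.LFunction 5 : ℂ))
    (k6 : -3 * x₂ - 4 * x₈ + 3 * x₉ - 4 * x₁₀ = (W.LFunction 6 : ℂ))
    (k7 : -x₁ + 2 * x₂ + x₃ + 8 * x₅ + x₇ + 2 * x₉ = (W.LFunction 7 : ℂ))
    (k8 : 2 * x₁ - x₂ + 4 * x₄ + 2 * x₇ + 2 * x₈ + x₉ + 2 * x₁₀ = (W.LFunction 8 : ℂ))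
    (k9 : -x₁ + 4 * x₂ + 2 * x₃ - 4 * x₄ + 13 * x₅ + x₇ + 6 * x₈ + 4 * x₉ - 6 * x₁₀ = (W.LFunction 9 : ℂ))
    (k13 : 2 * x₃ - 12 * x₄ + 14 * x₅ - 8 * x₆ - 2 * x₈ + 2 * x₁₀ = (W.LFunction 13 : ℂ))
    (k15 : -4 * x₁ + 5 * x₂ + 2 * x₃ - 16 * x₄ + 24 * x₅ + 4 * x₇ + 4 * x₈ + 5 * x₉ - 4 * x₁₀ =
      (W.LFunction 15 : ℂ))
    (k21 : -6 * x₁ + 5 * x₂ + 2 * x₃ - 16 * x₄ + 32 * x₅ + 6 * x₇ - 4 * x₈ + 5 * x₉ + 4 * x₁₀ =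
      (W.LFunction 21 : ℂ))
    (k26 : -x₂ + 44 * x₄ + 24 * x₆ - 2 * x₈ + x₉ - 2 * x₁₀ = (W.LFunction 26 : ℂ))
    (k39 : x₂ + 8 * x₃ - 64 * x₄ + 56 * x₅ - 32 * x₆ + 4 * x₈ + x₉ - 4 * x₁₀ = (W.LFunction 39 : ℂ)) :
    (x₁ = -1 ∧ x₂ = -1 ∧ x₃ = 0 ∧ x₄ = 0 ∧ x₅ = 0 ∧ x₆ = 0 ∧ x₇ = 1 ∧ x₈ = 1 / 4 ∧ x₉ = -1 ∧ x₁₀ = -1 / 4) ∨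
      (x₁ = 9 / 2 ∧ x₂ = 3 / 2 ∧ x₃ = -14 ∧ x₄ = 0 ∧ x₅ = 2 ∧ x₆ = 0 ∧ x₇ = -9 / 2 ∧ x₈ = -1 / 4 ∧
        x₉ = 3 / 2 ∧ x₁₀ = 1 / 4) ∨
      (x₁ = 1 / 2 ∧ x₂ = 1 / 2 ∧ x₃ = 0 ∧ x₄ = 0 ∧ x₅ = 0 ∧ x₆ = 0 ∧ x₇ = -1 / 2 ∧ x₈ = 1 / 4 ∧ x₉ = 1 / 2 ∧
        x₁₀ = -1 / 4) := by
  rw [W.LFunction_apply_one, Int.cast_one] at k1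
  -- the four basis-free relations, transported to the integers `aₙ(W)`
  have hz9 : W.LFunction 9 = 1 - W.LFunction 3 + 2 * W.LFunction 7 := by
    have : ((W.LFunction 9 : ℤ) : ℂ) = ((1 - W.LFunction 3 + 2 * W.LFunction 7 : ℤ) : ℂ) := by
      push_cast; linear_combination -k9 + k1 - k3 + 2 * k7
    exact_mod_cast this
  have hz15 : W.LFunction 15 = 2 + W.LFunction 5 + 2 * W.LFunction 7 := by
    have : ((W.LFunction 15 : ℤ) : ℂ) = ((2 + W.LFunction 5 + 2 * W.LFunction 7 : ℤ) : ℂ) := by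
      push_cast; linear_combination -k15 + 2 * k1 + k5 + 2 * k7
    exact_mod_cast this
  have hz21 : W.LFunction 21 = 2 + 2 * W.LFunction 3 + W.LFunction 5 + 2 * W.LFunction 7 := by
    have : ((W.LFunction 21 : ℤ) : ℂ) =
        ((2 + 2 * W.LFunction 3 + W.LFunction 5 + 2 * W.LFunction 7 : ℤ) : ℂ) := by
      push_cast; linear_combination -k21 + 2 * k1 + 2 * k3 + k5 + 2 * k7
    exact_mod_cast this
  have hz39 : W.LFunction 39 = 2 - 2 * W.LFunction 3 + W.LFunction 5 + 4 * W.LFunction 13 := by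
    have : ((W.LFunction 39 : ℤ) : ℂ) =
        ((2 - 2 * W.LFunction 3 + W.LFunction 5 + 4 * W.LFunction 13 : ℤ) : ℂ) := by
      push_cast; linear_combination -k39 + 2 * k1 - 2 * k3 + k5 + 4 * k13
    exact_mod_cast this
  -- the inverse of the pivot matrix
  have ex₁ : x₁ = (20/13 : ℂ) * 1 + (2/13 : ℂ) * (W.LFunction 2 : ℂ) + (23/26 : ℂ) * (W.LFunction 3 : ℂ) +
      (-25/26 : ℂ) * (W.LFunction 4 : ℂ) + (-12/13 : ℂ) * (W.LFunction 5 : ℂ) +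
      (-5/26 : ℂ) * (W.LFunction 6 : ℂ) + (6/13 : ℂ) * (W.LFunction 7 : ℂ) + (17/26 : ℂ) * (W.LFunction 8 : ℂ) +
      (-3/13 : ℂ) * (W.LFunction 13 : ℂ) + (-1/13 : ℂ) * (W.LFunction 26 : ℂ) := by
    linear_combination (20/13 : ℂ) * k1 + (2/13 : ℂ) * k2 + (23/26 : ℂ) * k3 + (-25/26 : ℂ) * k4 +
      (-12/13 : ℂ) * k5 + (-5/26 : ℂ) * k6 + (6/13 : ℂ) * k7 + (17/26 : ℂ) * k8 + (-3/13 : ℂ) * k13 +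
      (-1/13 : ℂ) * k26
  have ex₂ : x₂ = (7/13 : ℂ) * 1 + (2/13 : ℂ) * (W.LFunction 2 : ℂ) + (5/13 : ℂ) * (W.LFunction 3 : ℂ) +
      (-6/13 : ℂ) * (W.LFunction 4 : ℂ) + (-11/26 : ℂ) * (W.LFunction 5 : ℂ) + (-5/26 : ℂ) * (W.LFunction 6 : ℂ) +
      (6/13 : ℂ) * (W.LFunction 7 : ℂ) + (2/13 : ℂ) * (W.LFunction 8 : ℂ) + (-3/13 : ℂ) * (W.LFunction 13 : ℂ) +
      (-1/13 : ℂ) * (W.LFunction 26 : ℂ) := by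
    linear_combination (7/13 : ℂ) * k1 + (2/13 : ℂ) * k2 + (5/13 : ℂ) * k3 + (-6/13 : ℂ) * k4 +
      (-11/26 : ℂ) * k5 + (-5/26 : ℂ) * k6 + (6/13 : ℂ) * k7 + (2/13 : ℂ) * k8 + (-3/13 : ℂ) * k13 +
      (-1/13 : ℂ) * k26
  have ex₃ : x₃ = (-76/13 : ℂ) * 1 + (-5/13 : ℂ) * (W.LFunction 2 : ℂ) + (-45/13 : ℂ) * (W.LFunction 3 : ℂ) +
      (-137/39 : ℂ) * (W.LFunction 4 : ℂ) + (30/13 : ℂ) * (W.LFunction 5 : ℂ) +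
      (-10/13 : ℂ) * (W.LFunction 6 : ℂ) + (-15/13 : ℂ) * (W.LFunction 7 : ℂ) +
      (76/39 : ℂ) * (W.LFunction 8 : ℂ) + (14/13 : ℂ) * (W.LFunction 13 : ℂ) +
      (14/39 : ℂ) * (W.LFunction 26 : ℂ) := by
    linear_combination (-76/13 : ℂ) * k1 + (-5/13 : ℂ) * k2 + (-45/13 : ℂ) * k3 + (-137/39 : ℂ) * k4 +
      (30/13 : ℂ) * k5 + (-10/13 : ℂ) * k6 + (-15/13 : ℂ) * k7 + (76/39 : ℂ) * k8 + (14/13 : ℂ) * k13 +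
      (14/39 : ℂ) * k26
  have ex₄ : x₄ = (1/24 : ℂ) * (W.LFunction 2 : ℂ) + (11/24 : ℂ) * (W.LFunction 4 : ℂ) +
      (1/12 : ℂ) * (W.LFunction 6 : ℂ) + (-1/4 : ℂ) * (W.LFunction 8 : ℂ) := by
    linear_combination (1/24 : ℂ) * k2 + (11/24 : ℂ) * k4 + (1/12 : ℂ) * k6 + (-1/4 : ℂ) * k8
  have ex₅ : x₅ = (11/13 : ℂ) * 1 + (2/39 : ℂ) * (W.LFunction 2 : ℂ) + (6/13 : ℂ) * (W.LFunction 3 : ℂ) +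
      (20/39 : ℂ) * (W.LFunction 4 : ℂ) + (-4/13 : ℂ) * (W.LFunction 5 : ℂ) + (4/39 : ℂ) * (W.LFunction 6 : ℂ) +
      (2/13 : ℂ) * (W.LFunction 7 : ℂ) + (-11/39 : ℂ) * (W.LFunction 8 : ℂ) + (-1/13 : ℂ) * (W.LFunction 13 : ℂ) +
      (-1/39 : ℂ) * (W.LFunction 26 : ℂ) := by
    linear_combination (11/13 : ℂ) * k1 + (2/39 : ℂ) * k2 + (6/13 : ℂ) * k3 + (20/39 : ℂ) * k4 +
      (-4/13 : ℂ) * k5 + (4/39 : ℂ) * k6 + (2/13 : ℂ) * k7 + (-11/39 : ℂ) * k8 + (-1/13 : ℂ) * k13 +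
      (-1/39 : ℂ) * k26
  have ex₆ : x₆ = (-1/12 : ℂ) * (W.LFunction 2 : ℂ) + (-5/6 : ℂ) * (W.LFunction 4 : ℂ) +
      (-1/6 : ℂ) * (W.LFunction 6 : ℂ) + (11/24 : ℂ) * (W.LFunction 8 : ℂ) +
      (1/24 : ℂ) * (W.LFunction 26 : ℂ) := by
    linear_combination (-1/12 : ℂ) * k2 + (-5/6 : ℂ) * k4 + (-1/6 : ℂ) * k6 + (11/24 : ℂ) * k8 +
      (1/24 : ℂ) * k26
  have ex₇ : x₇ = (-20/13 : ℂ) * 1 + (7/39 : ℂ) * (W.LFunction 2 : ℂ) + (-23/26 : ℂ) * (W.LFunction 3 : ℂ) +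
      (-29/78 : ℂ) * (W.LFunction 4 : ℂ) + (12/13 : ℂ) * (W.LFunction 5 : ℂ) +
      (-11/78 : ℂ) * (W.LFunction 6 : ℂ) + (-6/13 : ℂ) * (W.LFunction 7 : ℂ) + (9/26 : ℂ) * (W.LFunction 8 : ℂ) +
      (3/13 : ℂ) * (W.LFunction 13 : ℂ) + (1/13 : ℂ) * (W.LFunction 26 : ℂ) := by
    linear_combination (-20/13 : ℂ) * k1 + (7/39 : ℂ) * k2 + (-23/26 : ℂ) * k3 + (-29/78 : ℂ) * k4 +
      (12/13 : ℂ) * k5 + (-11/78 : ℂ) * k6 + (-6/13 : ℂ) * k7 + (9/26 : ℂ) * k8 + (3/13 : ℂ) * k13 +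
      (1/13 : ℂ) * k26
  have ex₈ : x₈ = (1/26 : ℂ) * 1 + (-5/52 : ℂ) * (W.LFunction 2 : ℂ) + (-3/26 : ℂ) * (W.LFunction 3 : ℂ) +
      (71/156 : ℂ) * (W.LFunction 4 : ℂ) + (1/13 : ℂ) * (W.LFunction 5 : ℂ) + (3/52 : ℂ) * (W.LFunction 6 : ℂ) +
      (-1/26 : ℂ) * (W.LFunction 7 : ℂ) + (-7/39 : ℂ) * (W.LFunction 8 : ℂ) + (1/52 : ℂ) * (W.LFunction 13 : ℂ) +
      (1/156 : ℂ) * (W.LFunction 26 : ℂ) := by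
    linear_combination (1/26 : ℂ) * k1 + (-5/52 : ℂ) * k2 + (-3/26 : ℂ) * k3 + (71/156 : ℂ) * k4 +
      (1/13 : ℂ) * k5 + (3/52 : ℂ) * k6 + (-1/26 : ℂ) * k7 + (-7/39 : ℂ) * k8 + (1/52 : ℂ) * k13 +
      (1/156 : ℂ) * k26
  have ex₉ : x₉ = (7/13 : ℂ) * 1 + (-7/39 : ℂ) * (W.LFunction 2 : ℂ) + (5/13 : ℂ) * (W.LFunction 3 : ℂ) +
      (-5/39 : ℂ) * (W.LFunction 4 : ℂ) + (-11/26 : ℂ) * (W.LFunction 5 : ℂ) + (11/78 : ℂ) * (W.LFunction 6 : ℂ) +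
      (6/13 : ℂ) * (W.LFunction 7 : ℂ) + (2/13 : ℂ) * (W.LFunction 8 : ℂ) + (-3/13 : ℂ) * (W.LFunction 13 : ℂ) +
      (-1/13 : ℂ) * (W.LFunction 26 : ℂ) := by
    linear_combination (7/13 : ℂ) * k1 + (-7/39 : ℂ) * k2 + (5/13 : ℂ) * k3 + (-5/39 : ℂ) * k4 +
      (-11/26 : ℂ) * k5 + (11/78 : ℂ) * k6 + (6/13 : ℂ) * k7 + (2/13 : ℂ) * k8 + (-3/13 : ℂ) * k13 +
      (-1/13 : ℂ) * k26
  have ex₁₀ : x₁₀ = (-1/26 : ℂ) * 1 + (-2/13 : ℂ) * (W.LFunction 2 : ℂ) + (3/26 : ℂ) * (W.LFunction 3 : ℂ) +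
      (-8/39 : ℂ) * (W.LFunction 4 : ℂ) + (-1/13 : ℂ) * (W.LFunction 5 : ℂ) + (-3/52 : ℂ) * (W.LFunction 6 : ℂ) +
      (1/26 : ℂ) * (W.LFunction 7 : ℂ) + (7/39 : ℂ) * (W.LFunction 8 : ℂ) + (-1/52 : ℂ) * (W.LFunction 13 : ℂ) +
      (-1/156 : ℂ) * (W.LFunction 26 : ℂ) := by
    linear_combination (-1/26 : ℂ) * k1 + (-2/13 : ℂ) * k2 + (3/26 : ℂ) * k3 + (-8/39 : ℂ) * k4 +
      (-1/13 : ℂ) * k5 + (-3/52 : ℂ) * k6 + (1/26 : ℂ) * k7 + (7/39 : ℂ) * k8 + (-1/52 : ℂ) * k13 +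
      (-1/156 : ℂ) * k26
  obtain ⟨h4, h6, h8, h26, hcases⟩ := curveSide_fiftyTwo W ha2 h2N h3N hz9 hz15 hz21 hz39
  rcases hcases with ⟨h3, h5, h7, h13⟩ | ⟨h3, h5, h7, h13⟩ | ⟨h3, h5, h7, h13⟩
  · simp only [ha2, h3, h4, h5, h6, h7, h8, h13, h26] at ex₁ ex₂ ex₃ ex₄ ex₅ ex₆ ex₇ ex₈ ex₉ ex₁₀
    push_cast at ex₁ ex₂ ex₃ ex₄ ex₅ ex₆ ex₇ ex₈ ex₉ ex₁₀
    exact Or.inl ⟨by linear_combination ex₁, by linear_combination ex₂, by linear_combination ex₃,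
      by linear_combination ex₄, by linear_combination ex₅, by linear_combination ex₆, by linear_combination ex₇,
      by linear_combination ex₈, by linear_combination ex₉, by linear_combination ex₁₀⟩
  · simp only [ha2, h3, h4, h5, h6, h7, h8, h13, h26] at ex₁ ex₂ ex₃ ex₄ ex₅ ex₆ ex₇ ex₈ ex₉ ex₁₀
    push_cast at ex₁ ex₂ ex₃ ex₄ ex₅ ex₆ ex₇ ex₈ ex₉ ex₁₀
    exact Or.inr (Or.inl ⟨by linear_combination ex₁, by linear_combination ex₂, by linear_combination ex₃,
      by linear_combination ex₄, by linear_combination ex₅, by linear_combination ex₆, by linear_combination ex₇,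
      by linear_combination ex₈, by linear_combination ex₉, by linear_combination ex₁₀⟩)
  · simp only [ha2, h3, h4, h5, h6, h7, h8, h13, h26] at ex₁ ex₂ ex₃ ex₄ ex₅ ex₆ ex₇ ex₈ ex₉ ex₁₀
    push_cast at ex₁ ex₂ ex₃ ex₄ ex₅ ex₆ ex₇ ex₈ ex₉ ex₁₀
    exact Or.inr (Or.inr ⟨by linear_combination ex₁, by linear_combination ex₂, by linear_combination ex₃,
      by linear_combination ex₄, by linear_combination ex₅, by linear_combination ex₆, by linear_combination ex₇,
      by linear_combination ex₈, by linear_combination ex₉, by linear_combination ex₁₀⟩)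

end Coordinates

/-! ## §D The Fricke sieve -/

section Fricke

variable {N : ℕ} [NeZero N]


/-- **The Fricke sieve (abstract form, any level).**  Let `D` be an `X₀(N)`-datum, `B : ι → (ℍ → ℂ)` a finite linearly
independent family of functions with `⇑D.f = Σ xᵢ Bᵢ`, and suppose `w_N` acts on the family through a matrix:
`Bᵢ ∣₂ w_N = Σⱼ Φⱼᵢ Bⱼ`.  Then the coordinate vector is a `Φ`-eigenvector with eigenvalue `ε(D.f) ∈ {±1}`:
`Σᵢ Φⱼᵢ xᵢ = ε xⱼ` for every `j`.  (Atkin–Lehner: `w_N D.f = ε D.f`, tree theorem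
`IsNewform0.frickeInvolution_eq_smul_holds`, standard axioms.) [cite: AtkinLehner1970, Thm. 3] -/
theorem fricke_coords {W : WeierstrassCurve ℚ} (D : ModularParametrizationData W N) {ι : Type*} [Fintype ι]
    (B : ι → ℍ → ℂ) (hB : LinearIndependent ℂ B) (x : ι → ℂ) (hf : (⇑D.f : ℍ → ℂ) = ∑ i, x i • B i)
    (Φ : ι → ι → ℂ)
    (hW : ∀ i, (B i) ∣[(2 : ℤ)] (glCast (frickeGL N : GL (Fin 2) ℚ) : GL (Fin 2) ℝ) = ∑ j, Φ j i • B j) :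
    ∃ ε : ℂ, (ε = 1 ∨ ε = -1) ∧ ∀ j, ∑ i, Φ j i * x i = ε * x j := by
  refine ⟨frickeEigenvalue D.f, IsNewform0.frickeEigenvalue_eq_one_or_eq_neg_one_holds D.isNewformOf.1, ?_⟩
  set ε := frickeEigenvalue D.f with hε
  set w : GL (Fin 2) ℝ := (glCast (frickeGL N : GL (Fin 2) ℚ) : GL (Fin 2) ℝ) with hw
  have hAL := IsNewform0.frickeInvolution_eq_smul_holds D.isNewformOf.1
  -- as functions: `⇑D.f ∣₂ w_N = ε • ⇑D.f`
  -- at weight 2, `⇑(w_N g) = ⇑g ∣[2] w_N` (`N^{1−k/2} = 1`; tree `frickeInvolution_apply_eq_slash_holds`; inlined — the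
  -- standalone statement lives in another route's cone as `TameQuarticManinParity.coe_frickeInvolution_weight_two`)
  have hcoe : (⇑(frickeInvolution N 2 D.f) : ℍ → ℂ) = ⇑D.f ∣[(2 : ℤ)] (glCast (frickeGL N : GL (Fin 2) ℚ) : GL (Fin 2) ℝ) := by
    rw [frickeInvolution_apply_eq_slash_holds N 2 D.f]
    have h0 : (1 - ((2 : ℤ) : ℝ) / 2 : ℝ) = 0 := by norm_num
    rw [h0, Real.rpow_zero, Complex.ofReal_one, one_smul]
  have hfun : (⇑D.f : ℍ → ℂ) ∣[(2 : ℤ)] w = ε • (⇑D.f : ℍ → ℂ) := by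
    rw [hw, ← hcoe, hAL]; rfl
  have hσ : ∀ c : ℂ, σ w c = c := fun c ↦ by rw [hw]; exact σ_glCast _ c
  -- expand both sides on the family
  have hL : (⇑D.f : ℍ → ℂ) ∣[(2 : ℤ)] w = ∑ j, (∑ i, Φ j i * x i) • B j := by
    rw [hf, SlashAction.sum_slash]
    simp_rw [ModularForm.smul_slash, hσ, hW, Finset.smul_sum, smul_smul]
    rw [Finset.sum_comm]
    simp_rw [← Finset.sum_smul]
    refine Finset.sum_congr rfl fun j _ ↦ ?_
    simp_rw [mul_comm (x _) (Φ j _)]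
  have hR : ε • (⇑D.f : ℍ → ℂ) = ∑ j, (ε * x j) • B j := by
    rw [hf, Finset.smul_sum]; simp_rw [smul_smul]
  have hdiff : ∑ j, (∑ i, Φ j i * x i - ε * x j) • B j = 0 := by
    simp_rw [sub_smul, Finset.sum_sub_distrib, ← hL, ← hR, hfun, sub_self]
  intro j
  exact sub_eq_zero.mp (Fintype.linearIndependent_iff.mp hB _ hdiff j)

/-- **Level 52: the Fricke sieve removes the odd parts.**  On the `σ`-closed basis `C₁..C₁₀` the `w₅₂`-row through
`C₇ ↦ κ₇ C₈`, `κ₇ = −¼` reads `−¼·x₇ = ε·x₈`; with `ε = ±1` this fails for both odd parts (`1/8 ≠ ±1/4`,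
`9/8 ≠ ∓1/4`) and holds for `52a` with `ε = −1` (`= −w(52a)`).  So, given §C's trichotomy, the coordinate vector is
`52a`'s. [cite: AtkinLehner1970, Thm. 3] [cite: CremonaAlgorithms1997, Table 3 (N = 52)] -/
theorem coeffVector_fiftyTwo_of_fricke (x₁ x₂ x₃ x₄ x₅ x₆ x₇ x₈ x₉ x₁₀ : ℂ)
    (hx : (x₁ = -1 ∧ x₂ = -1 ∧ x₃ = 0 ∧ x₄ = 0 ∧ x₅ = 0 ∧ x₆ = 0 ∧ x₇ = 1 ∧ x₈ = 1 / 4 ∧ x₉ = -1 ∧ x₁₀ = -1 / 4) ∨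
      (x₁ = 9 / 2 ∧ x₂ = 3 / 2 ∧ x₃ = -14 ∧ x₄ = 0 ∧ x₅ = 2 ∧ x₆ = 0 ∧ x₇ = -9 / 2 ∧ x₈ = -1 / 4 ∧
        x₉ = 3 / 2 ∧ x₁₀ = 1 / 4) ∨
      (x₁ = 1 / 2 ∧ x₂ = 1 / 2 ∧ x₃ = 0 ∧ x₄ = 0 ∧ x₅ = 0 ∧ x₆ = 0 ∧ x₇ = -1 / 2 ∧ x₈ = 1 / 4 ∧ x₉ = 1 / 2 ∧
        x₁₀ = -1 / 4))
    {ε : ℂ} (hε : ε = 1 ∨ ε = -1) (hrow : -(1 / 4 : ℂ) * x₇ = ε * x₈) :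
    (x₁ = -1 ∧ x₂ = -1 ∧ x₃ = 0 ∧ x₄ = 0 ∧ x₅ = 0 ∧ x₆ = 0 ∧ x₇ = 1 ∧ x₈ = 1 / 4 ∧ x₉ = -1 ∧ x₁₀ = -1 / 4) ∧
      ε = -1 := by
  rcases hx with h | ⟨-, -, -, -, -, -, h7, h8, -, -⟩ | ⟨-, -, -, -, -, -, h7, h8, -, -⟩
  · have h' := h
    obtain ⟨-, -, -, -, -, -, h7, h8, -, -⟩ := h'
    rw [h7, h8] at hrow
    refine ⟨h, ?_⟩
    rcases hε with rfl | rfl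
    · norm_num at hrow
    · rfl
  · exfalso; rw [h7, h8] at hrow; rcases hε with rfl | rfl <;> norm_num at hrow
  · exfalso; rw [h7, h8] at hrow; rcases hε with rfl | rfl <;> norm_num at hrow

end Fricke

end Summit.BirchSwinnertonDyer.BirchSwinnertonDyer.Theorems.ManinLocalTwoThree.LevelFiftyTwo
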